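/-
Origin: expansion seat `planner-pub-hodgecm-pv12-g2-0`, handover 2026-08-18 (`HOME/pub-hodgecm-pv12-g2/lean/Pv12g2/ArchCFock.lean`, md5 fcc7dc83, 552 lines);
landed by the gen-6 packager in gate run 22 as `HodgeCM/PerL34/ArchCFock.lean` (verbatim).
-/
/-
Origin: HOME/pub-hodgecm-pv12-g2/lean/Pv12g2/ArchCFock.lean — session planner-pub-hodgecm-pv12-g2-0 (unit
pub-hodgecm-pv12-g2, DAG-node prover #12 gen 2, the Fock-model seat), LEMMAS.md v5 §9 **seam S4** (claimed in
HOME/STATUS.md Log 2026-08-18T04:33Z): the D5 constructor `ArchCDatum.ofFock` that the carver's seam table names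
("BRIDGE missing: `ArchCDatum.F/ιX/X/φ₀/ωT := ⊗_b (Fock model κ_b-part)` (D5) … with pv12's `isGeneratedBy_*` the
`gen` field then follows BY NAME") and that pv06's `ArchCGen.lean` (`Iff.rfl`) anticipates.
Intended final place: `HodgeCM/PerL34/ArchCFock.lean`, namespace `HodgeCM.PerL34.Fock` (§§1–3) and
`HodgeCM.PerL34.ArchC` / `HodgeCM.PerL34` (§4).  Imports LANDED modules only (`ArchC` pv06 run 18/21, `ArchBGen`/`ArchB`
pv12 run 20, `Arch` carver run 18) + one Mathlib file; no rewrite needed.  Asserts nothing: no axiom, no placeholder proof.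
-/
import Summits.HodgeConjecture.HodgeCM.PerL34.ArchC_2
import Summits.HodgeConjecture.HodgeCM.PerL34.ArchBGen
import Summits.HodgeConjecture.HodgeCM.PerL34.Arch
import Mathlib.LinearAlgebra.PiTensorProduct.Basic

set_option autoImplicit false
set_option linter.unusedSectionVars false

/-!
# Seam S4 (N28 → N29) in the typed sense: `ArchCDatum` from the Fock tensor product over the real places

NODES.  N28 = [PerL] v5 Lemma 4.1(b), tex ll. 483–487 (verbatim in `ArchB.lean`), proof ll. 496–513; N29 = Lemma
4.1(c), ll. 488–490, proof ll. 513–523 (verbatim in `ArchC.lean`).  The consumer of N28 is pv06's LANDED record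
`HodgeCM.PerL34.ArchC.ArchCDatum C D P` (`ArchC.lean` :228), whose two `[NODE N28]` HYPOTHESIS FIELDS are, verbatim,

  `gen : ∀ N : Submodule ℂ F, φ₀ ∈ N → (∀ k, ∀ φ ∈ N, X k φ ∈ N) → N = ⊤`
  `φ₀_eigen : ∀ t : Tg, ωT t φ₀ = (w t)⁻¹ • φ₀`

over POSITED data `F` (= 𝓕^κ_∞ := ⊗_b 𝓕^{κ_b}_b, l. 483–484), `X` (a spanning family of 𝔲(W)(L₀⊗ℝ)_ℂ = ⊕_b 𝔲(W_b)_ℂ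
acting factorwise), `φ₀` (= ⊗_b φ⁰_b), `Tg` (= T(L₀⊗ℝ) = ∏_b T_b) and `ωT` (ω_∞ restricted to the torus, factorwise).
The producers are pv12's KERNEL theorems over the three explicit local models (`ArchB.lean`/`ArchBGen.lean`, run 20):
`Fock.isGeneratedBy_E/M/I`, `Fock.isGeneratedBy_tmul` (binary), `weightOp_one`, `columnSubst_detZ`.

WHAT THIS FILE DOES (nothing cited, nothing posited beyond the labelled fields of §4; standard axiom trio):

* §1 KERNEL (Mathlib `PiTensorProduct` only).  `Fock.slot b f` = the factorwise operator "f in slot b, identity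
  elsewhere" on `⨂[ℂ] b, M b`; `Fock.isGeneratedBy_piTensor`: if every local κ_b-part `M b` is generated by `φ b`
  under the family `X b` (pv12's predicate `Fock.IsGeneratedBy`, = the field type of `ArchCDatum.gen` by `Iff.rfl`,
  pv06 `ArchCGen.isGeneratedBy_iff`), then `⨂[ℂ] b, M b` is generated by `⨂ₜ b, φ b` under the slot family indexed by
  `Σ b, ι b` — the n-ary ("jointly over the real places: U(⊕_b 𝔲_b) = ⊗_b U(𝔲_b) acting factorwise", `ArchC.lean`
  docstring of `gen`) form of pv12's binary `isGeneratedBy_tmul`, proved by induction on the set of freed slots;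
  `Fock.map_tprod_eq_prod_smul`: a pure tensor of local eigenvectors is a joint eigenvector of the factorwise torus
  action with the PRODUCT character.
* §2 `Fock.LocalFock` = ONE real place's κ_b-part WITH its local N28 content as fields (`gen`, `eigen`), and KERNEL
  constructors discharging those fields in pv12's explicit models: `LocalFock.ofE` (b ∈ D₁₂, `kappaPartE = ℂ·1`,
  l. 500), `LocalFock.ofI` (b = ι₁, `kappaPartI = ℂ·det(z)`, ll. 509–510) — on a LINE every linear torus action is
  scalar on the generator, so `eigen` is automatic and `gen` is `isGeneratedBy_E/_I`; `LocalFock.ofIcol` (b = ι₁ with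
  the torus acting on the column index through matrices `g t`: character `vac t · det (g t)` by `columnSubst_detZ`,
  l. 510 "U(2)_W acts by det (times the vacuum character)"); `LocalFock.ofM` (b ∈ Σ₁₂, `kappaPartM = ℂ[P]`, generated
  by 1 under the raising operator `c_b·(P·_)`, ll. 501–505: `gen` = `isGeneratedBy_M`; `eigen`: T_b acts on the
  polynomials by algebra automorphisms (variable substitution) times the vacuum character, and an algebra map fixes
  `1` — PerL's "(resp. on the vacuum) by the same character", l. 510–511, = pv12's (T) `weightOp_one` at group level).
* §3 `Fock.FockPlaces` = the finite set of real places `RP` with a `LocalFock` at each, and the JOINT objects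
  `F := ⨂[ℂ] b, (loc b).M`, `ιX := Σ b, (loc b).ι`, `X` (slots), `φ₀ := ⨂ₜ b, (loc b).φ`, `Tg := Π b, (loc b).T`,
  `ωT` (factorwise), `χ t := ∏ b, (loc b).χ (t b)`, with the two KERNEL theorems `FockPlaces.isGeneratedBy`
  (= `ArchCDatum.gen`) and `FockPlaces.ωT_φ₀ : ωT t φ₀ = χ t • φ₀`.
* §4 `ArchC.FockArchBridge C D P` = `ArchCDatum C D P` MINUS its two `[NODE N28]` fields, with `F/ιX/X/φ₀/Tg/ωT` FIXED
  to the joint Fock objects of a `FockPlaces`, every other field carried VERBATIM with pv06's label ([SETUP D4/D5/D7],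
  [NODE N21], [DEFINITIONAL]), plus ONE new field `w_loc : χ t = (w t)⁻¹` labelled [NODE N26 / DICTIONARY]: the
  integers e_b(Ψ_i) composing the type w ARE DEFINED by the action of U(W_{i,b}) on φ⁰_{i,b} (PerL §4.1 ll. 472–478;
  pv01 `ArchBookkeeping.N26_holds`, run 19), so the identification of the joint eigencharacter of φ⁰ = ⊗_b φ⁰_b with
  w⁻¹ is definitional bookkeeping of the intended model, not an inference of Lemma 4.1.  Then
  `FockArchBridge.toArchCDatum : ArchCDatum C D P` with `gen` and `φ₀_eigen` PROVED, and BY NAME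
  `Open_occ_of_fockBridges` / `N29_occ_of_fockBridges` (= pv06 `Open_occ_of_archC` / carver `N29_occ_of_archC` with
  the N28 fields DISCHARGED): the binder `A12/A34 : … → Nonempty (ArchCDatum …)` of `perL_of_leaves'` /
  `perL_of_dictLeaves` becomes `… → Nonempty (FockArchBridge …)`.

NET for LEMMAS §9 S4.  After this file the N28 content of the S4 seam is KERNEL end to end (local models → joint
tensor product → `ArchCDatum.gen/φ₀_eigen` → `H_occ` → `Open_occ`); what remains of S4 is ONLY instantiation data of
the posited shells — D4 (`ιT`, `ins`, `omg_ins`, `pure_detect`, node N21 `invariance` ← pv05 `KernelOperator*`),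
D7 (`Sm`, `Y`, `Sm_sub/Sm_dense/Y_mem`, `inf_invariance`), the [DEFINITIONAL] `wOccurs_of_eigenvector`, and the
N26 dictionary line `w_loc` — exactly parallel to pv11's `SeesawBridge` (S5 (12)) and pv02-g2's `QautBridge` (S5 (34)).
VACUITY NOTE (for referees 2/3/adv).  `LocalFock` deliberately allows ANY kernel-generated local model (so that the
T′_b-statement of l. 512–513, "the same computation after a change of basis of W_b", is served by the same record via
`ofIcol` with the base-changed matrices, and so that `Fock.isGeneratedBy_of_equiv` (pv12 `FockAddenda`, run 21) can
transport the explicit models to isomorphic ones); the INTENDED instance takes `loc b := ofE …` (b ∈ D₁₂), `ofM …`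
(b ∈ Σ₁₂), `ofIcol …` (b = ι₁) according to the sign type of b (N13 `lemma33b_signs`, N26), for which `gen`/`eigen`
are the kernel theorems named above.  A junk `LocalFock` (e.g. `M = 0`) makes `w_loc`/`pure_detect` unsatisfiable in
the intended model rather than proving anything: no field restates `H_occ`, and `toArchCDatum` adds no hypothesis.
-/

noncomputable section

open Function
open scoped TensorProduct

namespace HodgeCM
namespace PerL34

/-! ## §1  Kernel: generation and eigenvectors in a finite tensor product (Mathlib only) -/

namespace Fock

section PiTensor

variable {RP : Type*} [Fintype RP] [DecidableEq RP]
variable {M : RP → Type*} [∀ b, AddCommGroup (M b)] [∀ b, Module ℂ (M b)]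

/-- The factorwise operator "`f` in slot `b`, identity in every other slot" on `⨂[ℂ] b, M b`
(`X_k ⊗ 1 ⊗ ⋯ ⊗ 1` for `X_k ∈ 𝔲(W_b)_ℂ`: U(⊕_b 𝔲_b) = ⊗_b U(𝔲_b) acts factorwise). -/
def slot (b : RP) (f : M b →ₗ[ℂ] M b) : (⨂[ℂ] i, M i) →ₗ[ℂ] ⨂[ℂ] i, M i :=
  PiTensorProduct.map (update (fun i => (LinearMap.id : M i →ₗ[ℂ] M i)) b f)

/-- (Ported verbatim from the HodgeCMPerL package; no docstring in the source.) -/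
theorem slot_tprod (b : RP) (f : M b →ₗ[ℂ] M b) (m : Π i, M i) :
    slot b f (PiTensorProduct.tprod ℂ m) = PiTensorProduct.tprod ℂ (update m b (f (m b))) := by
  rw [slot, PiTensorProduct.map_tprod]
  congr 1
  funext i
  by_cases h : i = b
  · subst h
    rw [update_self, update_self]
  · rw [update_of_ne h, update_of_ne h, LinearMap.id_apply]

/-- **Generation is multiplicative over a finite tensor product** (the n-ary form of pv12's `isGeneratedBy_tmul`;
the "jointly over the real places" clause of `ArchCDatum.gen`): if each `M b` is generated by `φ b` under the family
`X b`, then `⨂[ℂ] b, M b` is generated by the pure tensor `⨂ₜ b, φ b` under all the slot operators. -/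
theorem isGeneratedBy_piTensor {ι : RP → Type*} (X : ∀ b, ι b → M b →ₗ[ℂ] M b) (φ : Π b, M b)
    (h : ∀ b, IsGeneratedBy (X b) (φ b)) :
    IsGeneratedBy (fun p : (Σ b, ι b) => slot p.1 (X p.1 p.2)) (PiTensorProduct.tprod ℂ φ) := by
  intro S h0 hS
  -- Claim: every pure tensor that agrees with `φ` outside a finite set `s` of freed slots lies in `S`.
  have key : ∀ (s : Finset RP) (m : Π b, M b), (∀ b, b ∉ s → m b = φ b) →
      PiTensorProduct.tprod ℂ m ∈ S := by
    intro s
    refine Finset.induction_on s ?_ ?_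
    · intro m hm
      have hmφ : m = φ := funext fun b => hm b (by simp)
      rw [hmφ]
      exact h0
    · intro a s ha ih m hm
      -- vary slot `a` linearly, all other slots of `m` fixed
      let L : M a →ₗ[ℂ] ⨂[ℂ] i, M i := (PiTensorProduct.tprod ℂ).toLinearMap m a
      have hL : ∀ x, L x = PiTensorProduct.tprod ℂ (update m a x) := fun x => rfl
      have hcomap : S.comap L = ⊤ := by
        refine h a (S.comap L) ?_ ?_
        · show L (φ a) ∈ S
          rw [hL]
          refine ih _ fun b hb => ?_
          by_cases hba : b = a
          · subst hba
            rw [update_self]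
          · rw [update_of_ne hba]
            exact hm b (by simp [hba, hb])
        · intro k x hx
          show L (X a k x) ∈ S
          have hx' : slot a (X a k) (L x) ∈ S := hS ⟨a, k⟩ (L x) hx
          rw [hL, slot_tprod, update_idem, update_self] at hx'
          rw [hL]
          exact hx'
      have hma : m a ∈ S.comap L := by
        rw [hcomap]
        exact Submodule.mem_top
      have hma' : L (m a) ∈ S := hma
      rw [hL, update_eq_self] at hma'
      exact hma'
  rw [eq_top_iff, ← PiTensorProduct.span_tprod_eq_top, Submodule.span_le]
  rintro _ ⟨m, rfl⟩
  exact key Finset.univ m fun b hb => absurd (Finset.mem_univ b) hb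

/-- **A pure tensor of local eigenvectors is a joint eigenvector with the product character**
(`φ₀ = ⊗_b φ⁰_b`, T(L₀⊗ℝ) = ∏_b T_b acting factorwise, ll. 485–486 read jointly). -/
theorem map_tprod_eq_prod_smul {T : RP → Type*} (ω : ∀ b, T b → M b →ₗ[ℂ] M b) (χ : ∀ b, T b → ℂ)
    (φ : Π b, M b) (h : ∀ b (t : T b), ω b t (φ b) = χ b t • φ b) (t : Π b, T b) :
    PiTensorProduct.map (fun b => ω b (t b)) (PiTensorProduct.tprod ℂ φ) =
      (∏ b, χ b (t b)) • PiTensorProduct.tprod ℂ φ := by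
  rw [PiTensorProduct.map_tprod]
  have hφ : (fun b => ω b (t b) (φ b)) = fun b => χ b (t b) • φ b := funext fun b => h b (t b)
  rw [hφ, MultilinearMap.map_smul_univ]

end PiTensor

/-! ## §2  One real place: the local κ_b-part with its N28 content, and the kernel constructors -/

/-- **One real place `b`**: the `κ_b`-part `M` = 𝓕^{κ_b}_b of the local Fock model with the action `X` of (a
spanning family `ι` of) `𝔲(W_b)_ℂ`, the distinguished vector `φ` = φ⁰_b, the compact torus `T` = T_b =
U(W_{1,b}) × U(W_{2,b}) acting by `ω` = ω_{W,b}|_{T_b} on the κ_b-part, and the character `χ` by which T_b acts on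
φ⁰_b — TOGETHER WITH the local content of Lemma 4.1(b): `gen` ("𝓕^κ_b is generated as a U(𝔲(W_b)_ℂ)-module by
φ⁰_b", l. 484–485) and `eigen` ("on which T_b acts by [a] character", l. 485–486).  For pv12's three explicit
models these two fields are KERNEL theorems: use the constructors `ofE`, `ofM`, `ofI`/`ofIcol` below.
(All carriers in `Type`, to fit `ArchCDatum.F/ιX/Tg : Type`.) -/
structure LocalFock where
  /-- [SETUP D5] the κ_b-part 𝓕^{κ_b}_b (a `Submodule` subtype of the polynomial model in the constructors). -/
  M : Type
  [instACG : AddCommGroup M]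
  [instMod : Module ℂ M]
  /-- [SETUP D5] index of a spanning family of 𝔲(W_b)_ℂ. -/
  ι : Type
  /-- [SETUP D5] ω_{W,b}(X_k) on the κ_b-part (𝔲(W_b) commutes with K_b ⊂ U(V_b), so the κ_b-part is stable). -/
  X : ι → M →ₗ[ℂ] M
  /-- [NODE N28] φ⁰_b. -/
  φ : M
  /-- [SETUP D4] T_b = U(W_{1,b}) × U(W_{2,b}). -/
  T : Type
  [instGrp : Group T]
  /-- [SETUP D5] ω_{W,b}(t) on the κ_b-part, t ∈ T_b. -/
  ω : T → M →ₗ[ℂ] M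
  /-- [SETUP D5 / NODE N26] the character of T_b on φ⁰_b (vacuum character × polynomial weight). -/
  χ : T → ℂ
  /-- [NODE N28, local] generation — KERNEL for `ofE/ofM/ofI/ofIcol` (pv12 `isGeneratedBy_E/M/I`). -/
  gen : IsGeneratedBy X φ
  /-- [NODE N28, local] φ⁰_b is a T_b-eigenvector with character χ — KERNEL for `ofE/ofM/ofI/ofIcol`. -/
  eigen : ∀ t, ω t φ = χ t • φ

namespace LocalFock

attribute [instance] LocalFock.instACG LocalFock.instMod LocalFock.instGrp

/-! ### Lines (cases E and I): every linear torus action on a line is scalar on its generator -/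

section Line

variable {V : Type} [AddCommGroup V] [Module ℂ V]

/-- The scalar by which an endomorphism of the line `ℂ·v` acts on `v`. -/
def lineScalar (v : V) (g : ↥(Submodule.span ℂ ({v} : Set V)) →ₗ[ℂ] ↥(Submodule.span ℂ ({v} : Set V))) : ℂ :=
  Classical.choose (Submodule.mem_span_singleton.mp (g ⟨v, Submodule.mem_span_singleton_self v⟩).2)

/-- (Ported verbatim from the HodgeCMPerL package; no docstring in the source.) -/
theorem lineScalar_spec (v : V)
    (g : ↥(Submodule.span ℂ ({v} : Set V)) →ₗ[ℂ] ↥(Submodule.span ℂ ({v} : Set V))) :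
    g ⟨v, Submodule.mem_span_singleton_self v⟩ = lineScalar v g • ⟨v, Submodule.mem_span_singleton_self v⟩ := by
  apply Subtype.ext
  rw [Submodule.coe_smul]
  exact (Classical.choose_spec
    (Submodule.mem_span_singleton.mp (g ⟨v, Submodule.mem_span_singleton_self v⟩).2)).symm

/-- A local κ_b-part which is a LINE `ℂ·v` (cases E: `v = 1 ∈ ℂ[M_{3×2}]`, and I: `v = det(z)`), under ANY operator
family and ANY linear torus action on the line: `gen` is pv12's `isGeneratedBy_of_span_singleton`, `eigen` holds
with `χ t :=` the scalar of `ω t` on `v`. -/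
def ofLine (v : V) {ι : Type}
    (X : ι → ↥(Submodule.span ℂ ({v} : Set V)) →ₗ[ℂ] ↥(Submodule.span ℂ ({v} : Set V)))
    (T : Type) [Group T]
    (ω : T → ↥(Submodule.span ℂ ({v} : Set V)) →ₗ[ℂ] ↥(Submodule.span ℂ ({v} : Set V))) : LocalFock where
  M := ↥(Submodule.span ℂ ({v} : Set V))
  ι := ι
  X := X
  φ := ⟨v, Submodule.mem_span_singleton_self v⟩
  T := T
  ω := ω
  χ := fun t => lineScalar v (ω t)
  gen := isGeneratedBy_of_span_singleton v X
  eigen := fun t => lineScalar_spec v (ω t)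

end Line

/-- **Case E** (b ∈ D₁₂, l. 500: "the U(3)-invariants … are the constants; φ⁰_b := 1"): the κ_b-part is pv12's
`kappaPartE = ℂ·1 ⊂ ℂ[M_{3×2}]`; any 𝔲(W_b)_ℂ-family, any torus action on the line. KERNEL (`isGeneratedBy_E`). -/
def ofE {ι : Type} (X : ι → ↥kappaPartE →ₗ[ℂ] ↥kappaPartE) (T : Type) [Group T]
    (ω : T → ↥kappaPartE →ₗ[ℂ] ↥kappaPartE) : LocalFock :=
  ofLine (V := EqModel) 1 X T ω

/-- **Case I** (b = ι₁, ll. 509–510: "𝓕^κ_{ι₁} = ℂ det(z), φ⁰_{ι₁} := det(z)"): the κ-part is pv12's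
`kappaPartI = ℂ·det(z)`; any family, any torus action on the line. KERNEL (`isGeneratedBy_I`). -/
def ofI {ι : Type} (X : ι → ↥kappaPartI →ₗ[ℂ] ↥kappaPartI) (T : Type) [Group T]
    (ω : T → ↥kappaPartI →ₗ[ℂ] ↥kappaPartI) : LocalFock :=
  ofLine (V := PlaneModel) detZ X T ω

/-- (Ported verbatim from the HodgeCMPerL package; no docstring in the source.) -/
theorem ofE_φ {ι : Type} (X : ι → ↥kappaPartE →ₗ[ℂ] ↥kappaPartE) (T : Type) [Group T]
    (ω : T → ↥kappaPartE →ₗ[ℂ] ↥kappaPartE) :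
    (ofE X T ω).φ = (⟨1, Submodule.mem_span_singleton_self (1 : EqModel)⟩ : ↥kappaPartE) := rfl

/-- (Ported verbatim from the HodgeCMPerL package; no docstring in the source.) -/
theorem ofI_φ {ι : Type} (X : ι → ↥kappaPartI →ₗ[ℂ] ↥kappaPartI) (T : Type) [Group T]
    (ω : T → ↥kappaPartI →ₗ[ℂ] ↥kappaPartI) :
    (ofI X T ω).φ = (⟨detZ, Submodule.mem_span_singleton_self detZ⟩ : ↥kappaPartI) := rfl

/-! ### Case I with the column action made explicit: character `vac · det` (l. 510) -/

section ColumnAction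

/-- `columnSubst g` preserves the line `ℂ·det(z)` (pv12 `columnSubst_detZ`: `det(z) ↦ det g · det(z)`, l. 512–513). -/
theorem columnSubst_mem_kappaPartI (g : Matrix (Fin 2) (Fin 2) ℂ) :
    ∀ f ∈ kappaPartI, (columnSubst g).toLinearMap f ∈ kappaPartI := by
  intro f hf
  obtain ⟨a, rfl⟩ := Submodule.mem_span_singleton.mp hf
  rw [AlgHom.toLinearMap_apply, map_smul, columnSubst_detZ, smul_smul]
  exact Submodule.smul_mem _ _ (Submodule.mem_span_singleton_self _)

/-- The torus action on the κ-part at ι₁ through the column matrices `g t` of `t ∈ T_{ι₁} ⊂ U(2)_W` (in the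
(W₁,W₂)-adapted basis: diagonal; for the T′-statement: conjugated by the base change, l. 512–513) times the vacuum
character `vac t` ([SETUP D5]: ω_{W,ι₁}|_{U(2)_W} = vacuum character ⊗ the substitution representation on the
column index, Adams 2007 §4 / Borel–Wallach VIII 2.4, quoted in `ArchB.lean`). -/
def colAction {T : Type} (vac : T → ℂ) (g : T → Matrix (Fin 2) (Fin 2) ℂ) (t : T) :
    ↥kappaPartI →ₗ[ℂ] ↥kappaPartI :=
  vac t • (columnSubst (g t)).toLinearMap.restrict (columnSubst_mem_kappaPartI (g t))

/-- (Ported verbatim from the HodgeCMPerL package; no docstring in the source.) -/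
theorem colAction_detZ {T : Type} (vac : T → ℂ) (g : T → Matrix (Fin 2) (Fin 2) ℂ) (t : T) :
    colAction vac g t ⟨detZ, Submodule.mem_span_singleton_self _⟩ =
      (vac t * (g t).det) • ⟨detZ, Submodule.mem_span_singleton_self _⟩ := by
  apply Subtype.ext
  simp only [colAction, LinearMap.smul_apply, Submodule.coe_smul, LinearMap.coe_restrict_apply,
    AlgHom.toLinearMap_apply, columnSubst_detZ, smul_smul]

/-- **Case I, explicit** ("on which U(W_{ι₁}) = U(2)_W acts by det (times the vacuum character)", l. 510): the
κ-part `ℂ·det(z)` with the column action; `χ t = vac t · det (g t)` and BOTH N28 fields KERNEL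
(`isGeneratedBy_I`, `columnSubst_detZ`). -/
def ofIcol {ι : Type} (X : ι → ↥kappaPartI →ₗ[ℂ] ↥kappaPartI) (T : Type) [Group T] (vac : T → ℂ)
    (g : T → Matrix (Fin 2) (Fin 2) ℂ) : LocalFock where
  M := ↥kappaPartI
  ι := ι
  X := X
  φ := ⟨detZ, Submodule.mem_span_singleton_self _⟩
  T := T
  ω := colAction vac g
  χ := fun t => vac t * (g t).det
  gen := isGeneratedBy_I X
  eigen := colAction_detZ vac g

end ColumnAction

/-! ### Case M (b ∈ Σ₁₂): `ℂ[P]`, generated by `1` under the raising operator; the torus fixes the vacuum -/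

section Mixed

/-- **Case M** (ll. 501–505: "invariants ℂ[P] … 𝔭′₊·P^k ∈ ℂ^× P^{k+1}, so ℂ[P] = U(𝔭′₊)·1 and φ⁰_b := 1"): the
κ_b-part is pv12's `kappaPartM = ℂ[P]`, the family `X` contains the raising operator `c_b·(P·_)`, `c_b ≠ 0`
(index `k₀`); the torus T_b acts on the polynomial model through algebra endomorphisms `π t` (variable
substitutions, [SETUP D5]) preserving the U(3)-invariants ℂ[P] (`hπ`, [SETUP D5]: T_b ⊂ U(W_b) commutes with
U(V_b) = U(3)) times the vacuum character `vac t`.  BOTH N28 fields KERNEL: `gen` = pv12 `isGeneratedBy_M`;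
`eigen`: an algebra map fixes `1`, so T_b acts on φ⁰_b = 1 by `vac` alone (l. 510–511 "(resp. on the vacuum) by
the same character"; pv12's (T) `weightOp_one` at group level). -/
def ofM {ι : Type} (X : ι → ↥kappaPartM →ₗ[ℂ] ↥kappaPartM) (cb : ℂ) (hcb : cb ≠ 0) (k₀ : ι)
    (hX : ∀ φ : ↥kappaPartM, ((X k₀ φ : ↥kappaPartM) : MixedModel) = cb • (P * φ))
    (T : Type) [Group T] (vac : T → ℂ) (π : T → (MixedModel →ₐ[ℂ] MixedModel))
    (hπ : ∀ t, ∀ f ∈ kappaPartM, (π t).toLinearMap f ∈ kappaPartM) : LocalFock where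
  M := ↥kappaPartM
  ι := ι
  X := X
  φ := ⟨1, one_mem_kappaPartM⟩
  T := T
  ω := fun t => vac t • (π t).toLinearMap.restrict (hπ t)
  χ := vac
  gen := isGeneratedBy_M X cb hcb k₀ hX
  eigen := fun t => by
    apply Subtype.ext
    simp only [LinearMap.smul_apply, Submodule.coe_smul, LinearMap.coe_restrict_apply,
      AlgHom.toLinearMap_apply, map_one]

end Mixed

end LocalFock

/-! ## §3  All real places: the joint κ-part `⊗_b 𝓕^{κ_b}_b` and its two N28 theorems -/

/-- The real places of L₀ (a finite type `RP`) with a local κ_b-part at each. -/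
structure FockPlaces where
  /-- [SETUP] the set of real places b of L₀. -/
  RP : Type
  [instFt : Fintype RP]
  [instDE : DecidableEq RP]
  /-- the local Fock data at b (intended: `LocalFock.ofE/ofM/ofIcol` by the sign type of b, N13/N26). -/
  loc : RP → LocalFock

namespace FockPlaces

attribute [instance] FockPlaces.instFt FockPlaces.instDE

variable (pl : FockPlaces)

/-- 𝓕^κ_∞ := ⊗_b 𝓕^{κ_b}_b (l. 483–484; κ = ⊠_b κ_b, l. 344). -/
abbrev F : Type := ⨂[ℂ] b : pl.RP, (pl.loc b).M

/-- Index of the joint spanning family of 𝔲(W)(L₀⊗ℝ)_ℂ = ⊕_b 𝔲(W_b)_ℂ. -/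
abbrev ιX : Type := Σ b : pl.RP, (pl.loc b).ι

/-- ω(X_k) for X_k ∈ 𝔲(W_b)_ℂ: the local operator in slot b. -/
def X (p : pl.ιX) : pl.F →ₗ[ℂ] pl.F := slot p.1 ((pl.loc p.1).X p.2)

/-- φ⁰ := ⊗_b φ⁰_b (ll. 485, 500, 505, 510). -/
def φ₀ : pl.F := PiTensorProduct.tprod ℂ fun b => (pl.loc b).φ

/-- T(L₀⊗ℝ) = ∏_b T_b. -/
abbrev Tg : Type := Π b : pl.RP, (pl.loc b).T

/-- ω_∞(t) = ⊗_b ω_{W,b}(t_b) on 𝓕^κ_∞. -/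
def ωT (t : pl.Tg) : pl.F →ₗ[ℂ] pl.F := PiTensorProduct.map fun b => (pl.loc b).ω (t b)

/-- The joint character of T(L₀⊗ℝ) on φ⁰: the product of the local ones. -/
def χ (t : pl.Tg) : ℂ := ∏ b, (pl.loc b).χ (t b)

/-- **`ArchCDatum.gen` for the joint Fock κ-part — KERNEL** (from the local `gen` fields by
`isGeneratedBy_piTensor`). -/
theorem isGeneratedBy : IsGeneratedBy pl.X pl.φ₀ :=
  isGeneratedBy_piTensor (fun b => (pl.loc b).X) (fun b => (pl.loc b).φ) fun b => (pl.loc b).gen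


-- port_pkg: scope closed for this part
end FockPlaces
end Fock
end PerL34
end HodgeCM
end
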